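import Summits.QuantumFields.BalabanUV.Beta.MultiscaleRemainderWRSRows
import Summits.QuantumFields.BalabanUV.Beta.CovariantTowerMatrix

/-!
# Beta / MultiscaleRemainderWRS — BRICK (c) OF THE (w4-d)-FLAT PROGRAMME: THE PER-BOX SMALLNESS OF THE PARAMETRIX REMAINDER TERM `K(h)·P`
# IN THE (2.16)∕WRS CURRENCY, ITS ROW SUPPORT, AND THE REDUCTIONS FOR `P = G′_□·M_h` (MODEL; flat transport; claim «WRS-PARAMETRIX-FLAT»
# journal l.25540; unit `b2b-balaban-beta-d4-p2`, GEN 12, MODEL crew; consumer: `MultiscaleParametrixWRS.parametrix_levelOp_wrs`)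

WHAT IS CERTIFIED (kernel, 0 sorry):
* `remK_mul_apply` — `K(h)·P` at a vector through `remK_eq`;
* **`row_remK_mul_le`** — THE PER-BOX SMALLNESS: under the bump data (`θ₁, θ₂, m`), the K-margin (`Kint`, `n ≤ Λ` there) and the two
  INTERIOR members of `P` (`𝔅_w·n²`, `𝔅_∇·n`): **`Σ_q |(K(h)P)(δ_q)(p)|·e^{κ′d_n(p₁,q₁)} ≤ dθ₁𝔅_∇Λ + dθ₁e^{κ′}𝔅_∇Λ + θ₂𝔅_wΛ² +
  2m·e^{4dκ′}|Cp|·a_max·𝔅_w`** for EVERY row — the four row bounds of `MultiscaleRemainderWRSRows` added up; for the scale-adapted cube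
  family every term is `O(1∕M)`, LEVEL-FREE (the `C_K` of `MultiscaleParametrixWRS`);
* **`remK_mul_apply_eq_zero`** — THE ROW SUPPORT: no bond at `x` carries `c∂h`, `Δ_ch(x) = 0`, `h` constant on the cell through `x` ⟹ the
  row `x` of `K(h)·P` vanishes (the `Kset` clause of `MultiscaleParametrixWRS`);
* `mulOp_single`, **`row_mul_mulOp_le`** (rows of `X·M_h` ≤ rows of `X` for `|h| ≤ 1`, any linear read-out: the interior members of
  `G′_□·M_h` follow from those of `G′_□` — this lineage's 17-D `real_sup_dirInv_le` ∕ 19b-D `real_grad_dirInv_le_of_flatGradient` by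
  duality), **`row_mulOp_mul_eq`** (the local part `M_h·X`: `|h(p₁)|` times the row of `X` — vanishes off `supp h`), `wrs_cmat_sdist_eq`
  (the same sums ARE an4's `wrs κ′ d (cmat ·)` rows for the weight `d(p,q) = d_n(p₁,q₁)`).

HONEST FRAMING: discharging `BetaPertH` makes Bałaban's UV stability UNCONDITIONAL — NOT the continuum limit, NOT the
Clay problem.  HONEST DEPENDENCY (verbatim): «continuum YM on T⁴ ⇐ BetaPertH ∧ nine spine estimates (0/9 proved);
BetaPertH ⇐ (D1) ∧ (D4) ∧ CAP+tail; G-an2-4 gates asym, D1 and NE2/3/4.»  THIS MODULE DISCHARGES NOTHING of `BetaPertH`,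
asserts NOTHING printed and cites nothing as a fact (ABSOLUTE RULE): [folklore] finite-dimensional bookkeeping about the pv21 component
MODEL; members, bump data and margins are DATA (hypotheses displayed in the signatures).  LOCI (shape only): [B9] =
`Balaban1985BackgroundPropagators` (3.16)/(3.19)/(3.24) pp. 393–394, (3.87)–(3.89) pp. 408–409; [B6] = `Balaban1984PropagatorsII`
(2.38)–(2.40) pp. 229–230; [II] = `Balaban1988RG2Cluster` (2.16) p. 15.  No class change on row D4 (critical-path width 0; D4 DISCHARGE
NO DATE); NOT BetaPertH, NOT continuum, NOT Clay, NOT summit progress.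
-/

open scoped BigOperators
open Finset

namespace Summit.QuantumFields.BalabanUV.Beta.MultiscaleRemainderWRS

open Summit.QuantumFields.BalabanUV.Beta.BoxPoincare (Box)
open Summit.QuantumFields.BalabanUV.Beta.MultiscaleCoerciveTorus
open Summit.QuantumFields.BalabanUV.Beta.MultiscaleDistance
open Summit.QuantumFields.BalabanUV.Beta.MultiscaleDistanceMetric (sdist_comm sdist_triangle_torus)
open Summit.QuantumFields.BalabanUV.Beta.MultiscaleDecayBudget
open Summit.QuantumFields.BalabanUV.Beta.AccretiveCombesThomasSandwichSite (sdist_corner_thresholds)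
open Summit.QuantumFields.BalabanUV.Beta.MultiscaleAveragingPointwise (abs_sum_col_mul_le block_filter_eq_cell)
open Summit.QuantumFields.BalabanUV.Beta.MultiscaleRemainderLeibniz (lapH leibRemRT leibRemRT_apply remK remK_eq)
open Summit.QuantumFields.BalabanUV.Beta.CovariantTowerMatrix (cmat wrs_cmat_eq)
open Literature.MathematicalPhysics.QuantumFieldTheory.Balaban1983to89
open Literature.MathematicalPhysics.QuantumFieldTheory.Balaban1983to89.B9Thm37Sum (mulOp mulOp_apply)
open Literature.MathematicalPhysics.QuantumFieldTheory.Balaban1983to89.B9Thm37Glue (covD covD_apply leibRemT leibRemT_apply)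
open Literature.MathematicalPhysics.QuantumFieldTheory.Balaban1983to89.B9Thm37GluePU (bsrc btgt bsrc_apply btgt_apply)
open Literature.MathematicalPhysics.QuantumFieldTheory.Balaban1983to89.B9Thm37GlueTorusCov (tblk)
open Literature.MathematicalPhysics.QuantumFieldTheory.Balaban1983to89.B9Thm37GlueTorusCovLevels (levelOp levelSum levelSum_apply)
open Literature.MathematicalPhysics.QuantumFieldTheory.Balaban1983to89.B13PerturbativeStep (wrs)
open B5TorusCover (UT Ctr ctrU)
open Summit.QuantumFields.BalabanUV.Beta.MultiscaleAveragingKernel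
open Summit.QuantumFields.BalabanUV.Beta.MultiscaleRemainderWRSRows

noncomputable section

variable {d : ℕ} {N : Fin d → ℕ} [∀ i, NeZero (N i)] [NeZero d] {Cp J K : Type} [Fintype Cp] [DecidableEq Cp]
  [Fintype J] [Fintype K] [DecidableEq K] (S : J → ℕ) (hS : ∀ l, 1 ≤ S l) (hdivS : ∀ l i, S l ∣ N i) (lvl : K → J)
  (zc : (k : K) → Ctr N (S (lvl k)))
  (hdisj : ∀ k k' v v', cellPt S hS hdivS lvl zc k v = cellPt S hS hdivS lvl zc k' v' → k = k')
  (hcover : ∀ x : UT N, ∃ k, ∃ v : Box d (S (lvl k)), cellPt S hS hdivS lvl zc k v = x)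
  (T : J → UT N → Cp → Cp → ℝ) (a : J → ℝ) (ω : J → UT N → ℝ)

include hdisj

/-! ## §3 THE END: the per-box WRS smallness of `K(h)·P`, its row support, and the reductions for `P = G′·M_h` -/

section End

variable (c : UT N × Fin d → ℝ) (Rm : UT N × Fin d → Cp → Cp → ℝ) (h : UT N → ℝ) (P : Module.End ℝ (UT N × Cp → ℝ))

omit hdisj [NeZero d] [Fintype K] [DecidableEq K] in
/-- `K(h)·P` at a vector, through `remK_eq`: the two Leibniz parts, the second-difference part, the averaging commutator. [folklore] -/
theorem remK_mul_apply (hRm : ∀ b i j, ∑ k, Rm b k i * Rm b k j = if i = j then (1 : ℝ) else 0)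
    (u : UT N × Cp → ℝ) (p : UT N × Cp) :
    (remK bsrc btgt c Rm (levelSum (fun l x => ctrU N (S l) (tblk (hS l) (hdivS l) x))
        (fun l x => ω l (ctrU N (S l) (tblk (hS l) (hdivS l) x))) T a) h * P) u p =
      leibRemT bsrc btgt c h (covD bsrc btgt c Rm (P u)) p + leibRemRT bsrc btgt c Rm h (covD bsrc btgt c Rm (P u)) p +
        (lapH bsrc btgt c h p.1 * P u p +
          (h p.1 * levelSum (fun l x => ctrU N (S l) (tblk (hS l) (hdivS l) x))
              (fun l x => ω l (ctrU N (S l) (tblk (hS l) (hdivS l) x))) T a (P u) p -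
            levelSum (fun l x => ctrU N (S l) (tblk (hS l) (hdivS l) x))
              (fun l x => ω l (ctrU N (S l) (tblk (hS l) (hdivS l) x))) T a (mulOp (h ∘ Prod.fst) (P u)) p)) := by
  rw [Module.End.mul_apply, remK_eq bsrc btgt c Rm hRm]
  simp only [LinearMap.add_apply, LinearMap.comp_apply, Pi.add_apply, Module.End.mul_apply, LinearMap.sub_apply,
    Pi.sub_apply, mulOp_apply, Function.comp_apply]

omit [Fintype K] in
/-- **BRICK (c): THE PER-BOX SMALLNESS OF THE REMAINDER TERM `K(h)·P` IN THE (2.16)∕WRS CURRENCY (MODEL; FLAT transport).**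
In the MODEL setting of a disjoint covering cube family (site scale `n`, scale-adapted distance `d_n`, block weights `ω_l(corner_l ·)`
supported on the level-`l` cells, column-orthonormal `T`, `a ≥ 0`, print size `a_lω_l²S_l^d ≤ a_max∕S_l²`), for a scalar bump `h`, an
operator `P` (in the parametrix: `P = G′_□·M_h`), an INTERIORITY predicate `Kint` and constants: IF
(bump) `|c∂h| ≤ θ₁` bondwise, `|Δ_ch| ≤ θ₂` sitewise, `|h(cell point) − h(cell corner)| ≤ m` on every cell;
(margin) `c∂h(b) ≠ 0 ⟹ Kint b₋`, `Δ_ch(x) ≠ 0 ⟹ Kint x`, `h` non-constant on a cell ⟹ the whole cell is `Kint`, and `n ≤ Λ` on `Kint`;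
(members) at `Kint` rows `Σ_q|P(δ_q)(p)|e^{κ′d_n(p₁,q₁)} ≤ 𝔅_w·n(p₁)²` and at `Kint` bonds `Σ_q|(∇_U Pδ_q)(b,i)|e^{κ′d_n(b₋,q₁)} ≤ 𝔅_∇·n(b₋)`;
THEN every row of `K(h)·P` obeys **`Σ_q |(K(h)P)(δ_q)(p)|·e^{κ′d_n(p₁,q₁)} ≤ dθ₁(1 + e^{κ′})𝔅_∇Λ + θ₂𝔅_wΛ² + 2m·e^{4dκ′}|Cp|·a_max·𝔅_w`**.
For the scale-adapted cube family (`θ₁ = |c₀|K₁∕(MS_j)`, `θ₂ = c₀²dK₂∕(MS_j)²`, `m = dLK₁∕M`, `Λ = L·S_j`) every term is `O(1∕M)`: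
LEVEL-FREE.  §2's four row bounds + `remK_eq`. [cite: Balaban1985BackgroundPropagators, (3.88)–(3.89) pp.408–409; Balaban1984PropagatorsII, (2.38)–(2.40) pp.229–230; Balaban1988RG2Cluster, (2.16) p.15] [folklore] -/
theorem row_remK_mul_le (hRm : ∀ b i j, ∑ k, Rm b k i * Rm b k j = if i = j then (1 : ℝ) else 0)
    (hflat : ∀ b k i, Rm b k i = if k = i then 1 else 0)
    (hT : ∀ l x i i', ∑ k, T l x k i * T l x k i' = if i = i' then (1 : ℝ) else 0) (ha : ∀ j, 0 ≤ a j)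
    (hsupp : ∀ l x, ω l (ctrU N (S l) (tblk (hS l) (hdivS l) x)) ≠ 0 → ∃ k v, lvl k = l ∧ cellPt S hS hdivS lvl zc k v = x)
    {amax : ℝ}
    (hscale : ∀ k, a (lvl k) * ω (lvl k) (ctrU N (S (lvl k)) (zc k)) ^ 2 * (S (lvl k) : ℝ) ^ d ≤ amax / (S (lvl k) : ℝ) ^ 2)
    (Kint : UT N → Prop) {θ₁ θ₂ m Λs 𝔅w 𝔅g κ' : ℝ} (hθ₁ : 0 ≤ θ₁) (hθ₂ : 0 ≤ θ₂) (hm : 0 ≤ m) (hΛs : 0 ≤ Λs)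
    (h𝔅w : 0 ≤ 𝔅w) (h𝔅g : 0 ≤ 𝔅g) (hκ' : 0 ≤ κ')
    (hdh : ∀ b, |c b * (h (btgt b) - h (bsrc b))| ≤ θ₁) (hlap : ∀ x, |lapH bsrc btgt c h x| ≤ θ₂)
    (hosc : ∀ k v, |h (cellPt S hS hdivS lvl zc k v) - h (ctrU N (S (lvl k)) (zc k))| ≤ m)
    (hKb : ∀ b, c b * (h (btgt b) - h (bsrc b)) ≠ 0 → Kint (bsrc b)) (hKl : ∀ x, lapH bsrc btgt c h x ≠ 0 → Kint x)
    (hKc : ∀ k v, h (cellPt S hS hdivS lvl zc k v) ≠ h (ctrU N (S (lvl k)) (zc k)) → ∀ w, Kint (cellPt S hS hdivS lvl zc k w))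
    (hKn : ∀ x, Kint x → (siteScale S hS hdivS lvl zc hcover x : ℝ) ≤ Λs)
    (hW1 : ∀ p : UT N × Cp, Kint p.1 →
      ∑ q, |P (Pi.single q 1) p| * Real.exp (κ' * sdist bsrc btgt (siteScale S hS hdivS lvl zc hcover) p.1 q.1) ≤
        𝔅w * (siteScale S hS hdivS lvl zc hcover p.1 : ℝ) ^ 2)
    (hW2 : ∀ (b : UT N × Fin d) (i : Cp), Kint (bsrc b) →
      ∑ q, |covD bsrc btgt c Rm (P (Pi.single q 1)) (b, i)| *
          Real.exp (κ' * sdist bsrc btgt (siteScale S hS hdivS lvl zc hcover) (bsrc b) q.1) ≤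
        𝔅g * (siteScale S hS hdivS lvl zc hcover (bsrc b) : ℝ))
    (p : UT N × Cp) :
    ∑ q, |(remK bsrc btgt c Rm (levelSum (fun l x => ctrU N (S l) (tblk (hS l) (hdivS l) x))
          (fun l x => ω l (ctrU N (S l) (tblk (hS l) (hdivS l) x))) T a) h * P) (Pi.single q 1) p| *
        Real.exp (κ' * sdist bsrc btgt (siteScale S hS hdivS lvl zc hcover) p.1 q.1) ≤
      d * θ₁ * 𝔅g * Λs + d * θ₁ * Real.exp κ' * 𝔅g * Λs + θ₂ * 𝔅w * Λs ^ 2 +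
        2 * m * Real.exp (4 * d * κ') * Fintype.card Cp * amax * 𝔅w := by
  have h1 := row_leibT_le S hS hdivS lvl zc hcover c Rm h P Kint hθ₁ hΛs h𝔅g hdh hKb hKn hW2 p
  have h2 := row_leibRT_le S hS hdivS lvl zc hcover c Rm h P Kint hflat hθ₁ hΛs h𝔅g hκ' hdh hKb hKn hW2 p
  have h3 := row_lap_le S hS hdivS lvl zc hcover c h P Kint hθ₂ h𝔅w hlap hKl hKn hW1 p
  have h4 := row_comm_le S hS hdivS lvl zc hdisj hcover T a ω h P Kint hT ha hsupp hscale hm h𝔅w hκ' hosc hKc hW1 p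
  set E : UT N × Cp → ℝ := fun q => Real.exp (κ' * sdist bsrc btgt (siteScale S hS hdivS lvl zc hcover) p.1 q.1) with hE
  have hsplit : ∀ q, |(remK bsrc btgt c Rm (levelSum (fun l x => ctrU N (S l) (tblk (hS l) (hdivS l) x))
        (fun l x => ω l (ctrU N (S l) (tblk (hS l) (hdivS l) x))) T a) h * P) (Pi.single q 1) p| ≤
      |leibRemT bsrc btgt c h (covD bsrc btgt c Rm (P (Pi.single q 1))) p| +
        |leibRemRT bsrc btgt c Rm h (covD bsrc btgt c Rm (P (Pi.single q 1))) p| +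
        |lapH bsrc btgt c h p.1 * P (Pi.single q 1) p| +
        |h p.1 * levelSum (fun l x => ctrU N (S l) (tblk (hS l) (hdivS l) x))
            (fun l x => ω l (ctrU N (S l) (tblk (hS l) (hdivS l) x))) T a (P (Pi.single q 1)) p -
          levelSum (fun l x => ctrU N (S l) (tblk (hS l) (hdivS l) x))
            (fun l x => ω l (ctrU N (S l) (tblk (hS l) (hdivS l) x))) T a (mulOp (h ∘ Prod.fst) (P (Pi.single q 1))) p| := by
    intro q
    rw [remK_mul_apply S hS hdivS T a ω c Rm h P hRm]
    refine (abs_add_le _ _).trans ((add_le_add (abs_add_le _ _) (abs_add_le _ _)).trans (le_of_eq ?_))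
    ring
  calc ∑ q, |(remK bsrc btgt c Rm (levelSum (fun l x => ctrU N (S l) (tblk (hS l) (hdivS l) x))
          (fun l x => ω l (ctrU N (S l) (tblk (hS l) (hdivS l) x))) T a) h * P) (Pi.single q 1) p| * E q
      ≤ ∑ q, (|leibRemT bsrc btgt c h (covD bsrc btgt c Rm (P (Pi.single q 1))) p| +
          |leibRemRT bsrc btgt c Rm h (covD bsrc btgt c Rm (P (Pi.single q 1))) p| +
          |lapH bsrc btgt c h p.1 * P (Pi.single q 1) p| +
          |h p.1 * levelSum (fun l x => ctrU N (S l) (tblk (hS l) (hdivS l) x))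
              (fun l x => ω l (ctrU N (S l) (tblk (hS l) (hdivS l) x))) T a (P (Pi.single q 1)) p -
            levelSum (fun l x => ctrU N (S l) (tblk (hS l) (hdivS l) x))
              (fun l x => ω l (ctrU N (S l) (tblk (hS l) (hdivS l) x))) T a (mulOp (h ∘ Prod.fst) (P (Pi.single q 1))) p|) *
          E q := Finset.sum_le_sum fun q _ => mul_le_mul_of_nonneg_right (hsplit q) (Real.exp_pos _).le
    _ = ∑ q, |leibRemT bsrc btgt c h (covD bsrc btgt c Rm (P (Pi.single q 1))) p| * E q +
          ∑ q, |leibRemRT bsrc btgt c Rm h (covD bsrc btgt c Rm (P (Pi.single q 1))) p| * E q +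
          ∑ q, |lapH bsrc btgt c h p.1 * P (Pi.single q 1) p| * E q +
          ∑ q, |h p.1 * levelSum (fun l x => ctrU N (S l) (tblk (hS l) (hdivS l) x))
              (fun l x => ω l (ctrU N (S l) (tblk (hS l) (hdivS l) x))) T a (P (Pi.single q 1)) p -
            levelSum (fun l x => ctrU N (S l) (tblk (hS l) (hdivS l) x))
              (fun l x => ω l (ctrU N (S l) (tblk (hS l) (hdivS l) x))) T a (mulOp (h ∘ Prod.fst) (P (Pi.single q 1))) p| *
            E q := by
        simp_rw [add_mul]
        rw [Finset.sum_add_distrib, Finset.sum_add_distrib, Finset.sum_add_distrib]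
    _ ≤ d * θ₁ * 𝔅g * Λs + d * θ₁ * Real.exp κ' * 𝔅g * Λs + θ₂ * 𝔅w * Λs ^ 2 +
          2 * m * Real.exp (4 * d * κ') * Fintype.card Cp * amax * 𝔅w := add_le_add (add_le_add (add_le_add h1 h2) h3) h4

omit [NeZero d] [Fintype K] in
/-- **THE ROWS OF `K(h)·P` VANISH OFF THE K-SET**: if no bond at `x` carries `c∂h`, `Δ_ch(x) = 0`, and `h` is constant on the cell through
`x`, then `(K(h)·P)(u)(x,i) = 0` for every `u` — each remainder term of the parametrix reads only a neighbourhood of `supp h`.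
[cite: Balaban1985BackgroundPropagators, (3.88) p.409] [folklore] -/
theorem remK_mul_apply_eq_zero (hRm : ∀ b i j, ∑ k, Rm b k i * Rm b k j = if i = j then (1 : ℝ) else 0)
    (hsupp : ∀ l x, ω l (ctrU N (S l) (tblk (hS l) (hdivS l) x)) ≠ 0 → ∃ k v, lvl k = l ∧ cellPt S hS hdivS lvl zc k v = x)
    (u : UT N × Cp → ℝ) (p : UT N × Cp)
    (hb1 : ∀ b, bsrc b = p.1 → c b * (h (btgt b) - h (bsrc b)) = 0)
    (hb2 : ∀ b, btgt b = p.1 → c b * (h (btgt b) - h (bsrc b)) = 0)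
    (hl : lapH bsrc btgt c h p.1 = 0)
    (hc : ∀ y, cellOf S hS hdivS lvl zc hcover y = cellOf S hS hdivS lvl zc hcover p.1 → h y = h p.1) :
    (remK bsrc btgt c Rm (levelSum (fun l x => ctrU N (S l) (tblk (hS l) (hdivS l) x))
        (fun l x => ω l (ctrU N (S l) (tblk (hS l) (hdivS l) x))) T a) h * P) u p = 0 := by
  classical
  obtain ⟨x, i⟩ := p
  rw [remK_mul_apply S hS hdivS T a ω c Rm h P hRm, leibRemT_apply, leibRemRT_apply, hl, zero_mul, zero_add,
    comm_apply_cell S hS hdivS lvl zc hdisj hcover T a ω hsupp h (P u) x i (cellOf S hS hdivS lvl zc hcover x) rfl]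
  have e1 : ∑ b, (if bsrc b = x then c b * (h (btgt b) - h (bsrc b)) else 0) * covD bsrc btgt c Rm (P u) (b, i) = 0 :=
    Finset.sum_eq_zero fun b _ => by
      split_ifs with hb
      · rw [hb1 b hb, zero_mul]
      · rw [zero_mul]
  have e2 : ∑ b, (if btgt b = x then c b * (h (btgt b) - h (bsrc b)) else 0) *
      ∑ k, Rm b k i * covD bsrc btgt c Rm (P u) (b, k) = 0 :=
    Finset.sum_eq_zero fun b _ => by
      split_ifs with hb
      · rw [hb2 b hb, zero_mul]
      · rw [zero_mul]
  have e4 : ∑ y ∈ univ.filter (fun y : UT N => ctrU N (S (lvl (cellOf S hS hdivS lvl zc hcover x)))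
        (tblk (hS (lvl (cellOf S hS hdivS lvl zc hcover x))) (hdivS (lvl (cellOf S hS hdivS lvl zc hcover x))) y) =
        ctrU N (S (lvl (cellOf S hS hdivS lvl zc hcover x))) (zc (cellOf S hS hdivS lvl zc hcover x))),
      ∑ j, (∑ i', T (lvl (cellOf S hS hdivS lvl zc hcover x)) x i' i * T (lvl (cellOf S hS hdivS lvl zc hcover x)) y i' j) *
        ((h x - h y) * P u (y, j)) = 0 := by
    refine Finset.sum_eq_zero fun y hy => Finset.sum_eq_zero fun j _ => ?_
    have hyk : cellOf S hS hdivS lvl zc hcover y = cellOf S hS hdivS lvl zc hcover x := by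
      rw [block_filter_eq_cell S hS hdivS lvl zc hdisj hcover] at hy
      exact (mem_filter.mp hy).2
    rw [hc y hyk, sub_self, zero_mul, mul_zero]
  simp only at e1 e2 e4 ⊢
  rw [e1, e2, e4, mul_zero, add_zero, zero_add]

omit hdisj [∀ i, NeZero (N i)] [NeZero d] [Fintype Cp] [Fintype J] [Fintype K] [DecidableEq K] in
/-- `M_h δ_q = h(q₁)·δ_q`. [folklore] -/
theorem mulOp_single (q : UT N × Cp) : mulOp (h ∘ Prod.fst) (Pi.single q (1 : ℝ)) = h q.1 • (Pi.single q (1 : ℝ)) := by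
  classical
  funext r
  rw [mulOp_apply, Pi.smul_apply, smul_eq_mul, Function.comp_apply]
  by_cases hr : r = q
  · subst hr; rfl
  · rw [Pi.single_eq_of_ne hr, mul_zero, mul_zero]

omit hdisj [∀ i, NeZero (N i)] [NeZero d] [Fintype J] [Fintype K] [DecidableEq K] in
/-- **Rows of `X·M_h` are dominated by rows of `X`** when `|h| ≤ 1`: `|(X·M_h)(δ_q)(p)| = |h(q₁)|·|X(δ_q)(p)|` — so the interior members
of `G′_□·M_h` follow from those of `G′_□`, with the same constants, for every nonnegative row weight and every linear read-out `Φ`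
(`Φ = evaluation` for the sup rows, `Φ = ∇_U(·)(b,i)` for the gradient rows). [folklore] -/
theorem row_mul_mulOp_le (habs : ∀ x, |h x| ≤ 1) (X : Module.End ℝ (UT N × Cp → ℝ)) (Φ : (UT N × Cp → ℝ) →ₗ[ℝ] ℝ)
    (w : UT N × Cp → ℝ) (hw : ∀ q, 0 ≤ w q) :
    ∑ q, |Φ ((X * mulOp (h ∘ Prod.fst) : Module.End ℝ (UT N × Cp → ℝ)) (Pi.single q 1))| * w q ≤
      ∑ q, |Φ (X (Pi.single q 1))| * w q := by
  refine Finset.sum_le_sum fun q _ => mul_le_mul_of_nonneg_right ?_ (hw q)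
  rw [Module.End.mul_apply, mulOp_single, map_smul, map_smul, smul_eq_mul, abs_mul]
  calc |h q.1| * |Φ (X (Pi.single q 1))| ≤ 1 * |Φ (X (Pi.single q 1))| :=
        mul_le_mul_of_nonneg_right (habs q.1) (abs_nonneg _)
    _ = |Φ (X (Pi.single q 1))| := one_mul _

omit hdisj [∀ i, NeZero (N i)] [NeZero d] [Fintype J] [Fintype K] [DecidableEq K] in
/-- **The local part `M_h·X` in the WRS currency**: `Σ_q|(M_hX)(δ_q)(p)|w(q) = |h(p₁)|·Σ_q|X(δ_q)(p)|w(q)` — it vanishes off `supp h` and is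
dominated by the row of `X` on it (`|h| ≤ 1`). [cite: Balaban1985BackgroundPropagators, (3.87) p.409] [folklore] -/
theorem row_mulOp_mul_eq (X : Module.End ℝ (UT N × Cp → ℝ)) (w : UT N × Cp → ℝ) (p : UT N × Cp) :
    ∑ q, |(mulOp (h ∘ Prod.fst) * X : Module.End ℝ (UT N × Cp → ℝ)) (Pi.single q 1) p| * w q =
      |h p.1| * ∑ q, |X (Pi.single q 1) p| * w q := by
  rw [Finset.mul_sum]
  refine Finset.sum_congr rfl fun q _ => ?_
  rw [Module.End.mul_apply, mulOp_apply, Function.comp_apply, abs_mul, mul_assoc]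

omit hdisj [NeZero d] [Fintype J] [Fintype K] [DecidableEq K] in
/-- The same sums in an4's matrix currency: `wrs κ d (cmat X) p = Σ_q |X(δ_q)(p)|·e^{κ d(p,q)}` (this lineage's `wrs_cmat_eq`), recorded for
the weight `d(p,q) = d_n(p₁,q₁)` so that §3's bounds ARE `WRS`-row bounds for `MultiscaleParametrixWRS`. [folklore] -/
theorem wrs_cmat_sdist_eq (n : UT N → ℕ) (κ' : ℝ) (X : Module.End ℝ (UT N × Cp → ℝ)) (p : UT N × Cp) :
    wrs κ' (fun p q : UT N × Cp => sdist bsrc btgt n p.1 q.1) (cmat X) p =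
      ∑ q, |X (Pi.single q 1) p| * Real.exp (κ' * sdist bsrc btgt n p.1 q.1) :=
  wrs_cmat_eq κ' _ X p

end End

end

end Summit.QuantumFields.BalabanUV.Beta.MultiscaleRemainderWRS
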